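import Summits.Ventures.HodgeRepro2.T5SU11LegendreRodrigues
import Mathlib.Analysis.Calculus.LocalExtr.Rolle

/-!
# The zeros of `P_n`: `n` distinct simple zeros, all in `(−1, 1)` — by Rolle's theorem on Rodrigues' formula

Rodrigues' formula `2ⁿ n! · P_n = Dⁿ (X² − 1)ⁿ` (row 390, `T5SU11LegendreRodrigues.rodrigues`) and Rolle's theorem give
the classical picture of the zeros. For `k ≤ n` the `k`-th derivative of `(X² − 1)ⁿ` is `(X² − 1)^{n−k} · g_k`
(`exists_iterate_derivative_rodPoly_eq`), so it still vanishes at `±1` for `k < n`; if it has `k` distinct zeros in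
`(−1, 1)`, then together with `±1` it has `k + 2` zeros in `[−1, 1]`, and Rolle's theorem (`exists_derivative_root`,
from Mathlib's `exists_hasDerivAt_eq_zero`) places a zero of the next derivative strictly between any two
consecutive ones — `k + 1` distinct zeros in `(−1, 1)` (`exists_finset_roots`; the consecutive pairs are read off
`Finset.orderEmbOfFin`, the increasing enumeration of a finite set). At `k = n`:

  **`P_n` has `n` distinct zeros in `(−1, 1)`**   (`exists_finset_legP_roots`),

and since `natDegree (legPoly n) = n` (row 372) these are ALL the roots and each is SIMPLE:

  **`(legPoly n).roots = s.val`, `rootMultiplicity r (legPoly n) = 1` for `r ∈ s`, `P_n(x) = 0 ↔ x ∈ s`**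
  (`roots_legPoly_eq`, `rootMultiplicity_legPoly_eq_one`, `legP_eq_zero_iff`, all packaged in `legendre_zeros`);

in particular **`P_n(x) ≠ 0` for `|x| ≥ 1`** (`legP_ne_zero_of_one_le_abs`) and the zero set is symmetric under
`x ↦ −x` (`legP_neg_eq_zero_iff`). On the group the spherical functions of even parameter never vanish,
`φ_{2n+2}(g) = P_n(φ_4(g))` with `φ_4(g) ≥ 1` (row 363's `one_le_legP`); nothing is claimed about (N).

Blind lane: Mathlib + the HodgeRepro2 prefix only; no sorry; axioms ⊆ {propext, Classical.choice,
Quot.sound}.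
-/

namespace Summit.Ventures.HodgeRepro2.T5SU11LegendreZeros

open Polynomial Set
open T5SU11SphericalLegendreAll T5SU11SphericalLegendreLaplace T5SU11JacobiPhaseLawEven
  T5SU11JacobiLegendreLeading T5SU11LegendreRodrigues

/-! ### The derivatives of `(X² − 1)ⁿ` keep the factor `(X² − 1)^{n−k}` -/

/-- **`Dᵏ (X² − 1)ⁿ = (X² − 1)^{n−k} · g`** for `k ≤ n`. -/
theorem exists_iterate_derivative_rodPoly_eq (n : ℕ) :
    ∀ k, k ≤ n → ∃ g : ℝ[X], derivative^[k] (((X : ℝ[X]) ^ 2 - 1) ^ n) = (X ^ 2 - 1) ^ (n - k) * g := by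
  intro k
  induction k with
  | zero => intro _; exact ⟨1, by simp⟩
  | succ k ih =>
    intro hk
    obtain ⟨g, hg⟩ := ih (Nat.le_of_succ_le hk)
    obtain ⟨m, hm⟩ : ∃ m, n - k = m + 1 := ⟨n - k - 1, by omega⟩
    refine ⟨2 * ((m : ℝ[X]) + 1) * X * g + (X ^ 2 - 1) * derivative g, ?_⟩
    rw [Function.iterate_succ_apply', hg, hm, show n - (k + 1) = m by omega, derivative_mul, derivative_pow_succ]
    simp only [derivative_sub, derivative_X_sq, derivative_one, sub_zero, map_add, map_one, C_eq_natCast, C_ofNat]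
    ring

/-- **`(Dᵏ (X² − 1)ⁿ)(1) = 0`** for `k < n`. -/
theorem eval_one_iterate_derivative_rodPoly (n : ℕ) {k : ℕ} (hk : k < n) :
    (derivative^[k] (((X : ℝ[X]) ^ 2 - 1) ^ n)).eval 1 = 0 := by
  obtain ⟨g, hg⟩ := exists_iterate_derivative_rodPoly_eq n k hk.le
  rw [hg, eval_mul, eval_pow, eval_sub, eval_pow, eval_X, eval_one, one_pow, sub_self,
    zero_pow (by omega), zero_mul]

/-- **`(Dᵏ (X² − 1)ⁿ)(−1) = 0`** for `k < n`. -/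
theorem eval_neg_one_iterate_derivative_rodPoly (n : ℕ) {k : ℕ} (hk : k < n) :
    (derivative^[k] (((X : ℝ[X]) ^ 2 - 1) ^ n)).eval (-1) = 0 := by
  obtain ⟨g, hg⟩ := exists_iterate_derivative_rodPoly_eq n k hk.le
  rw [hg, eval_mul, eval_pow, eval_sub, eval_pow, eval_X, eval_one, neg_one_sq, sub_self,
    zero_pow (by omega), zero_mul]

/-! ### Rolle's theorem for polynomials -/

/-- **Rolle**: a polynomial vanishing at `a < b` has a zero of its derivative in `(a, b)`. -/
theorem exists_derivative_root (p : ℝ[X]) {a b : ℝ} (hab : a < b) (ha : p.eval a = 0) (hb : p.eval b = 0) :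
    ∃ c ∈ Ioo a b, (derivative p).eval c = 0 := by
  obtain ⟨c, hc, hc'⟩ := exists_hasDerivAt_eq_zero (f := fun x => p.eval x) (f' := fun x => (derivative p).eval x)
    hab p.continuousOn (ha.trans hb.symm) (fun x _ => p.hasDerivAt x)
  exact ⟨c, hc, hc'⟩

/-! ### `k` distinct zeros of the `k`-th derivative in `(−1, 1)` -/

/-- **`Dᵏ (X² − 1)ⁿ` has `k` distinct zeros in `(−1, 1)`** for every `k ≤ n` (Rolle, inductively). -/
theorem exists_finset_roots (n : ℕ) :
    ∀ k, k ≤ n → ∃ s : Finset ℝ, s.card = k ∧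
      ∀ r ∈ s, r ∈ Ioo (-1 : ℝ) 1 ∧ (derivative^[k] ((X ^ 2 - 1) ^ n)).eval r = 0 := by
  intro k
  induction k with
  | zero => intro _; exact ⟨∅, rfl, by simp⟩
  | succ k ih =>
    intro hk
    obtain ⟨s, hcard, hs⟩ := ih (Nat.le_of_succ_le hk)
    have hm1 : (-1 : ℝ) ∉ s := fun h => by have := (hs _ h).1.1; linarith
    have h1 : (1 : ℝ) ∉ insert (-1 : ℝ) s := by
      simp only [Finset.mem_insert, not_or]
      exact ⟨by norm_num, fun h => by have := (hs _ h).1.2; linarith⟩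
    set t : Finset ℝ := insert 1 (insert (-1) s) with ht
    have htcard : t.card = k + 2 := by
      rw [ht, Finset.card_insert_of_notMem h1, Finset.card_insert_of_notMem hm1, hcard]
    -- every point of `t` lies in `[−1, 1]` and is a zero of the `k`-th derivative
    have htmem : ∀ r ∈ t, r ∈ Icc (-1 : ℝ) 1 ∧ (derivative^[k] (((X : ℝ[X]) ^ 2 - 1) ^ n)).eval r = 0 := by
      intro r hr
      rw [ht, Finset.mem_insert, Finset.mem_insert] at hr
      rcases hr with rfl | rfl | hr
      · exact ⟨⟨by norm_num, le_rfl⟩, eval_one_iterate_derivative_rodPoly n (by omega)⟩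
      · exact ⟨⟨le_rfl, by norm_num⟩, eval_neg_one_iterate_derivative_rodPoly n (by omega)⟩
      · exact ⟨Ioo_subset_Icc_self (hs r hr).1, (hs r hr).2⟩
    -- the increasing enumeration of `t`
    let e : Fin (k + 2) ↪o ℝ := t.orderEmbOfFin htcard
    have he : ∀ i, e i ∈ t := fun i => Finset.orderEmbOfFin_mem t htcard i
    -- Rolle between consecutive points
    have hroll : ∀ i : Fin (k + 1), ∃ c ∈ Ioo (e (Fin.castSucc i)) (e i.succ),
        (derivative^[k + 1] (((X : ℝ[X]) ^ 2 - 1) ^ n)).eval c = 0 := by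
      intro i
      have hlt : e (Fin.castSucc i) < e i.succ := e.strictMono Fin.castSucc_lt_succ
      rw [Function.iterate_succ_apply']
      exact exists_derivative_root _ hlt (htmem _ (he _)).2 (htmem _ (he _)).2
    choose c hc hc0 using hroll
    have hcmono : StrictMono c := by
      refine Fin.strictMono_iff_lt_succ.mpr fun i => ?_
      calc c (Fin.castSucc i) < e (Fin.castSucc i).succ := (hc _).2
        _ = e (Fin.castSucc i.succ) := by rw [Fin.succ_castSucc]
        _ < c i.succ := (hc _).1
    refine ⟨Finset.univ.image c, ?_, ?_⟩
    · rw [Finset.card_image_of_injective _ hcmono.injective, Finset.card_univ, Fintype.card_fin]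
    · intro r hr
      obtain ⟨i, -, rfl⟩ := Finset.mem_image.mp hr
      refine ⟨⟨?_, ?_⟩, hc0 i⟩
      · have := (htmem _ (he (Fin.castSucc i))).1.1
        linarith [(hc i).1]
      · have := (htmem _ (he i.succ)).1.2
        linarith [(hc i).2]

/-! ### The zeros of `P_n` -/

/-- **`P_n` has `n` distinct zeros in `(−1, 1)`.** -/
theorem exists_finset_legP_roots (n : ℕ) :
    ∃ s : Finset ℝ, s.card = n ∧ ∀ r ∈ s, r ∈ Ioo (-1 : ℝ) 1 ∧ legP n r = 0 := by
  obtain ⟨s, hcard, hs⟩ := exists_finset_roots n n le_rfl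
  refine ⟨s, hcard, fun r hr => ⟨(hs r hr).1, ?_⟩⟩
  have h := (hs r hr).2
  rw [← rodrigues n, eval_mul, eval_C] at h
  rw [legP_eq_eval]
  rcases mul_eq_zero.mp h with h | h
  · exfalso
    have : (0 : ℝ) < 2 ^ n * (n.factorial : ℝ) := by positivity
    linarith
  · exact h

/-- `legPoly n ≠ 0`. -/
theorem legPoly_ne_zero (n : ℕ) : legPoly n ≠ 0 := by
  intro h
  have := leadingCoeff_legPoly n
  rw [h, leadingCoeff_zero] at this
  exact (legLead_pos n).ne this

/-- **`n` zeros of `P_n` are all its roots**: if `s` has `n` elements, all zeros of `P_n`, then `(legPoly n).roots = s.val`. -/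
theorem roots_legPoly_eq (n : ℕ) {s : Finset ℝ} (hcard : s.card = n) (hs : ∀ r ∈ s, legP n r = 0) :
    (legPoly n).roots = s.val := by
  have hle : s.val ≤ (legPoly n).roots := by
    rw [Multiset.le_iff_subset s.nodup]
    intro r hr
    rw [Finset.mem_val] at hr
    rw [mem_roots (legPoly_ne_zero n)]
    exact (legP_eq_eval n r).symm.trans (hs r hr)
  have hcard' : Multiset.card (legPoly n).roots ≤ Multiset.card s.val := by
    rw [Finset.card_val, hcard]
    exact (card_roots' (legPoly n)).trans (natDegree_legPoly n).le
  exact (Multiset.eq_of_le_of_card_le hle hcard').symm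

/-- **Every zero of `P_n` is simple**: `rootMultiplicity r (legPoly n) = 1` for `r ∈ s`. -/
theorem rootMultiplicity_legPoly_eq_one (n : ℕ) {s : Finset ℝ} (hcard : s.card = n) (hs : ∀ r ∈ s, legP n r = 0)
    {r : ℝ} (hr : r ∈ s) : rootMultiplicity r (legPoly n) = 1 := by
  rw [← count_roots, roots_legPoly_eq n hcard hs]
  exact Multiset.count_eq_one_of_mem s.nodup (Finset.mem_val.mpr hr)

/-- **`P_n(x) = 0 ↔ x ∈ s`** for the `n`-element zero set `s`. -/
theorem legP_eq_zero_iff (n : ℕ) {s : Finset ℝ} (hcard : s.card = n) (hs : ∀ r ∈ s, legP n r = 0) (x : ℝ) :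
    legP n x = 0 ↔ x ∈ s := by
  refine ⟨fun hx => ?_, hs x⟩
  have : x ∈ (legPoly n).roots := by
    rw [mem_roots (legPoly_ne_zero n)]
    exact (legP_eq_eval n x).symm.trans hx
  rw [roots_legPoly_eq n hcard hs, Finset.mem_val] at this
  exact this

/-- **THE ZEROS OF `P_n`**: there is an `n`-element set `s ⊂ (−1, 1)` with `P_n(x) = 0 ↔ x ∈ s`, every zero simple. -/
theorem legendre_zeros (n : ℕ) :
    ∃ s : Finset ℝ, s.card = n ∧ (∀ r ∈ s, r ∈ Ioo (-1 : ℝ) 1) ∧ (∀ x, legP n x = 0 ↔ x ∈ s)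
      ∧ ∀ r ∈ s, rootMultiplicity r (legPoly n) = 1 := by
  obtain ⟨s, hcard, hs⟩ := exists_finset_legP_roots n
  exact ⟨s, hcard, fun r hr => (hs r hr).1, legP_eq_zero_iff n hcard (fun r hr => (hs r hr).2),
    fun r hr => rootMultiplicity_legPoly_eq_one n hcard (fun r hr => (hs r hr).2) hr⟩

/-- **`P_n(x) ≠ 0` for `|x| ≥ 1`**: all zeros lie in `(−1, 1)`. -/
theorem legP_ne_zero_of_one_le_abs (n : ℕ) {x : ℝ} (hx : 1 ≤ |x|) : legP n x ≠ 0 := by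
  obtain ⟨s, -, hs, hiff, -⟩ := legendre_zeros n
  intro h
  have hxs := (hiff x).mp h
  have := hs x hxs
  rcases le_abs.mp hx with h' | h'
  · linarith [this.2]
  · linarith [this.1]

/-- **The zero set is symmetric**: `P_n(−x) = 0 ↔ P_n(x) = 0`. -/
theorem legP_neg_eq_zero_iff (n : ℕ) (x : ℝ) : legP n (-x) = 0 ↔ legP n x = 0 := by
  rw [legP_neg]
  constructor
  · intro h
    rcases mul_eq_zero.mp h with h | h
    · exact absurd h (pow_ne_zero n (by norm_num))
    · exact h
  · intro h
    rw [h, mul_zero]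

/-- **The roots of `legPoly n` all lie in `(−1, 1)`.** -/
theorem mem_Ioo_of_mem_roots (n : ℕ) {r : ℝ} (hr : r ∈ (legPoly n).roots) : r ∈ Ioo (-1 : ℝ) 1 := by
  obtain ⟨s, hcard, hs, hiff, -⟩ := legendre_zeros n
  rw [mem_roots (legPoly_ne_zero n)] at hr
  exact hs r ((hiff r).mp ((legP_eq_eval n r).trans hr))

/-- **`legPoly n` has exactly `n` roots counted with multiplicity, all simple**: `Multiset.card (legPoly n).roots = n`
and `(legPoly n).roots.Nodup`. -/
theorem card_roots_legPoly (n : ℕ) : Multiset.card (legPoly n).roots = n ∧ (legPoly n).roots.Nodup := by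
  obtain ⟨s, hcard, -, hiff, -⟩ := legendre_zeros n
  have h := roots_legPoly_eq n hcard fun r hr => (hiff r).mpr hr
  rw [h, Finset.card_val, hcard]
  exact ⟨rfl, s.nodup⟩

end Summit.Ventures.HodgeRepro2.T5SU11LegendreZeros
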